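import Literature.MathematicalPhysics.QuantumLattice.GaugeGroups
import Literature.Analysis.FluidPDE.TaoAveragedQuaternionRotation
import HarnessLib

/-!
# Haar measure on `SU(2)` via unit quaternions

The normalised Haar measure of `SU(2) = Matrix.specialUnitaryGroup (Fin 2) ℂ` (the tree's
`QuantumFieldTheory.haarProbability`, i.e. Mathlib's `haarMeasure ⊤`) made explicit through the
quaternion model `S³ ≅ SU(2)`:

* `quatMatrix q = [[z, w], [-w̄, z̄]]` (`q = z + w j`), a multiplicative map `ℍ → M₂(ℂ)` taking unit
  quaternions onto `SU(2)` (`quatMatrix_mem_specialUnitaryGroup`, `quatMatrix_su2Quat`: every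
  `U ∈ SU(2)` is `[[a, b], [-b̄, ā]]`, from `U* = adj U`);
* `quatToSU2 x = quatMatrix (x/‖x‖)`, the radial projection `ℍ ∖ {0} → SU(2)` (junk `1` at `0`),
  measurable, and *equivariant*: `U · quatToSU2 x = quatToSU2 (su2Quat U · x)` (`mul_quatToSU2`);
* `su2BallMeasure`, the law of `quatToSU2 x` for `x` uniform in the unit ball of `ℍ ≅ ℝ⁴`, is a
  left-invariant probability measure (`map_mul_left_su2BallMeasure`: left multiplication by a
  unit quaternion is a linear isometry of `ℍ`, preserving Lebesgue measure and the ball), hence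
  **equals the Haar probability measure** (`haarProbability_su2_eq_su2BallMeasure`, by Mathlib's
  uniqueness `haarMeasure_eq_iff`);
* the integration formulas `∫ f dHaar = vol(B⁴)⁻¹ ∫_{‖x‖<1} f(quatToSU2 x) dx`
  (`lintegral_haarProbability_su2`, `integral_haarProbability_su2`) and `vol(B⁴) = π²/2`
  (`volume_ball_quat`).

This is the statement "the pushforward of the normalized Haar measure under `τ : SU(2) → S³` is
the uniform probability measure on `S³`, and conversely" used by Chatterjee (Probab. Math. Phys.
7 (2026) 339, arXiv:2401.10507, §3.2, and Lemma 5.1/Cor. 5.2 for its coordinate form) in the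
proof of his `SU(2)` Yang–Mills–Higgs scaling limit (constructive-qft.S19,
`ContinuumLimits.chatterjee_su2_higgs`), with the uniform measure on `S³` presented as the cone
(radial-projection) measure of the unit ball — the form from which chart densities follow by
Fubini (DAG node N1 of the S19 proof plan). Sources for `SU(2) ≅ S³` and Haar measure as the
invariant volume: Sepanski, *Compact Lie Groups* (2007) §1.1.4, §1.4; Bröcker–tom Dieck,
*Representations of Compact Lie Groups* (1985) I (1.10) and I §5 (invariant integration) — the
sources already used by the tree's `GaugeGroups.lean`.

## Design

* Everything is phrased for Mathlib's `Matrix.specialUnitaryGroup (Fin 2) ℂ` with the instances of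
  `GaugeGroups.lean` (compact topological group, Borel σ-algebra); `SU(2)` is second countable,
  recorded as a local instance (`secondCountableTopology_su2`) because instance search does not
  see through `Matrix`/`Submonoid` coercions.
* `ℍ` carries no global measurable structure in Mathlib; we use the *local* Borel instances
  `Tao2016.quatMeasurableSpace`/`quatBorelSpace` and the unit-quaternion isometries `quatLmul` of
  `Literature.Analysis.FluidPDE.TaoAveragedQuaternionRotation` (reused, not re-declared), so that
  `volume` on `ℍ` is the Lebesgue measure of the real inner product space `ℍ ≅ ℝ⁴`.
* No named facts are introduced; all statements are proved.
-/

open MeasureTheory Quaternion Filter Topology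
open scoped Quaternion ENNReal

noncomputable section

namespace Literature.MathematicalPhysics.QuantumLattice

/-- `SU(2)` as Mathlib's `Matrix.specialUnitaryGroup (Fin 2) ℂ`. -/
local notation "SU2" => Matrix.specialUnitaryGroup (Fin 2) ℂ

/-! ### The quaternion model of `SU(2)` -/

/-- The `2 × 2` complex matrix of a quaternion `q = z + w j` (`z = re + imI·i`, `w = imJ + imK·i`):
`[[z, w], [-w̄, z̄]]`. [folklore] -/
def quatMatrix (q : ℍ) : Matrix (Fin 2) (Fin 2) ℂ :=
  !![(⟨q.re, q.imI⟩ : ℂ), ⟨q.imJ, q.imK⟩; ⟨-q.imJ, q.imK⟩, ⟨q.re, -q.imI⟩]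

/-- Entry `(0,0)` of `quatMatrix q` is `z = re + imI·i`. [folklore] -/
@[simp] theorem quatMatrix_apply_00 (q : ℍ) : quatMatrix q 0 0 = ⟨q.re, q.imI⟩ := rfl

/-- Entry `(0,1)` of `quatMatrix q` is `w = imJ + imK·i`. [folklore] -/
@[simp] theorem quatMatrix_apply_01 (q : ℍ) : quatMatrix q 0 1 = ⟨q.imJ, q.imK⟩ := rfl

/-- Entry `(1,0)` of `quatMatrix q` is `-w̄`. [folklore] -/
@[simp] theorem quatMatrix_apply_10 (q : ℍ) : quatMatrix q 1 0 = ⟨-q.imJ, q.imK⟩ := rfl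

/-- Entry `(1,1)` of `quatMatrix q` is `z̄`. [folklore] -/
@[simp] theorem quatMatrix_apply_11 (q : ℍ) : quatMatrix q 1 1 = ⟨q.re, -q.imI⟩ := rfl

/-- `quatMatrix` is multiplicative. [folklore] -/
theorem quatMatrix_mul (p q : ℍ) : quatMatrix (p * q) = quatMatrix p * quatMatrix q := by
  ext i j
  fin_cases i <;> fin_cases j <;>
    apply Complex.ext <;>
    simp [quatMatrix, Matrix.mul_apply, Fin.sum_univ_two, Quaternion.re_mul, Quaternion.imI_mul,
      Quaternion.imJ_mul, Quaternion.imK_mul] <;> ring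

/-- `quatMatrix 1 = 1`. [folklore] -/
theorem quatMatrix_one : quatMatrix 1 = 1 := by
  ext i j
  fin_cases i <;> fin_cases j <;> apply Complex.ext <;> simp [quatMatrix]

/-- `quatMatrix (r • q) = r • quatMatrix q` for real `r`. [folklore] -/
theorem quatMatrix_smul (r : ℝ) (q : ℍ) : quatMatrix (r • q) = (r : ℂ) • quatMatrix q := by
  ext i j
  fin_cases i <;> fin_cases j <;> apply Complex.ext <;> simp [quatMatrix]

/-- `quatMatrix (-q) = -quatMatrix q`. [folklore] -/
theorem quatMatrix_neg (q : ℍ) : quatMatrix (-q) = -quatMatrix q := by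
  ext i j
  fin_cases i <;> fin_cases j <;> apply Complex.ext <;> simp [quatMatrix]

/-- `star (quatMatrix q) * quatMatrix q = ‖q‖² • 1`. [folklore] -/
theorem star_quatMatrix_mul_self (q : ℍ) :
    star (quatMatrix q) * quatMatrix q = ((normSq q : ℝ) : ℂ) • (1 : Matrix (Fin 2) (Fin 2) ℂ) := by
  ext i j
  fin_cases i <;> fin_cases j <;> apply Complex.ext <;>
    simp [quatMatrix, Matrix.mul_apply, Fin.sum_univ_two, Matrix.star_apply,
      Quaternion.normSq_def', sq, Complex.mul_re, Complex.mul_im] <;> ring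

/-- `det (quatMatrix q) = ‖q‖²`. [folklore] -/
theorem det_quatMatrix (q : ℍ) : (quatMatrix q).det = ((normSq q : ℝ) : ℂ) := by
  rw [Matrix.det_fin_two]
  apply Complex.ext <;> simp [quatMatrix, Quaternion.normSq_def', sq, Complex.mul_re, Complex.mul_im] <;>
    ring

/-- A unit quaternion gives an element of `SU(2)`. [folklore] -/
theorem quatMatrix_mem_specialUnitaryGroup {q : ℍ} (hq : ‖q‖ = 1) :
    quatMatrix q ∈ Matrix.specialUnitaryGroup (Fin 2) ℂ := by
  have h1 : normSq q = 1 := by rw [Quaternion.normSq_eq_norm_mul_self, hq, mul_one]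
  rw [Matrix.mem_specialUnitaryGroup_iff]
  refine ⟨?_, by rw [det_quatMatrix, h1]; simp⟩
  rw [Matrix.mem_unitaryGroup_iff']
  rw [star_quatMatrix_mul_self, h1]
  simp

/-! ### Every element of `SU(2)` comes from a unit quaternion -/

/-- The quaternion `re U₀₀ + im U₀₀ · i + re U₀₁ · j + im U₀₁ · k` of a matrix `U ∈ SU(2)` (its
first row). [folklore] -/
def su2Quat (U : SU2) : ℍ :=
  ⟨((U : Matrix (Fin 2) (Fin 2) ℂ) 0 0).re, ((U : Matrix (Fin 2) (Fin 2) ℂ) 0 0).im,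
    ((U : Matrix (Fin 2) (Fin 2) ℂ) 0 1).re, ((U : Matrix (Fin 2) (Fin 2) ℂ) 0 1).im⟩

/-- For `U ∈ SU(2)` the conjugate transpose is the adjugate: both are inverses of `U`. [folklore] -/
theorem star_coe_eq_adjugate (U : SU2) :
    star (U : Matrix (Fin 2) (Fin 2) ℂ) = (U : Matrix (Fin 2) (Fin 2) ℂ).adjugate := by
  have hU := Matrix.mem_specialUnitaryGroup_iff.1 U.2
  have h1 : star (U : Matrix (Fin 2) (Fin 2) ℂ) * U = 1 := Matrix.mem_unitaryGroup_iff'.1 hU.1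
  have h2 : (U : Matrix (Fin 2) (Fin 2) ℂ) * (U : Matrix (Fin 2) (Fin 2) ℂ).adjugate = 1 := by
    rw [Matrix.mul_adjugate, hU.2, one_smul]
  calc star (U : Matrix (Fin 2) (Fin 2) ℂ)
      = star (U : Matrix (Fin 2) (Fin 2) ℂ) * ((U : Matrix (Fin 2) (Fin 2) ℂ) * (U : Matrix _ _ ℂ).adjugate) := by
        rw [h2, mul_one]
    _ = (U : Matrix (Fin 2) (Fin 2) ℂ).adjugate := by rw [← mul_assoc, h1, one_mul]

/-- The second row of `U ∈ SU(2)` is determined by the first: `U₁₀ = -conj U₀₁`. [folklore] -/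
theorem su2_apply_10 (U : SU2) :
    (U : Matrix (Fin 2) (Fin 2) ℂ) 1 0 = -(starRingEnd ℂ) ((U : Matrix (Fin 2) (Fin 2) ℂ) 0 1) := by
  have h := congrFun (congrFun (star_coe_eq_adjugate U) 1) 0
  rw [Matrix.adjugate_fin_two, Matrix.star_apply] at h
  simp only [Matrix.of_apply, Matrix.cons_val', Matrix.cons_val_zero, Matrix.cons_val_one,
    Matrix.cons_val_fin_one] at h
  have h' : (U : Matrix (Fin 2) (Fin 2) ℂ) 1 0 = -star ((U : Matrix (Fin 2) (Fin 2) ℂ) 0 1) := by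
    rw [h, neg_neg]
  rw [h', Complex.star_def]

/-- The second row of `U ∈ SU(2)` is determined by the first: `U₁₁ = conj U₀₀`. [folklore] -/
theorem su2_apply_11 (U : SU2) :
    (U : Matrix (Fin 2) (Fin 2) ℂ) 1 1 = (starRingEnd ℂ) ((U : Matrix (Fin 2) (Fin 2) ℂ) 0 0) := by
  have h := congrFun (congrFun (star_coe_eq_adjugate U) 0) 0
  rw [Matrix.adjugate_fin_two, Matrix.star_apply] at h
  simp only [Matrix.of_apply, Matrix.cons_val', Matrix.cons_val_zero, Matrix.cons_val_fin_one] at h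
  rw [← h, Complex.star_def]

/-- `U = quatMatrix (su2Quat U)` for `U ∈ SU(2)`: the quaternion model is onto. [folklore] -/
theorem quatMatrix_su2Quat (U : SU2) : quatMatrix (su2Quat U) = (U : Matrix (Fin 2) (Fin 2) ℂ) := by
  ext i j
  fin_cases i <;> fin_cases j
  · simp [su2Quat]
  · simp [su2Quat]
  · show quatMatrix (su2Quat U) 1 0 = (U : Matrix (Fin 2) (Fin 2) ℂ) 1 0
    rw [su2_apply_10]; apply Complex.ext <;> simp [su2Quat]
  · show quatMatrix (su2Quat U) 1 1 = (U : Matrix (Fin 2) (Fin 2) ℂ) 1 1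
    rw [su2_apply_11]; apply Complex.ext <;> simp [su2Quat]

/-- `su2Quat U` is a unit quaternion (`det U = 1`). [folklore] -/
theorem normSq_su2Quat (U : SU2) : normSq (su2Quat U) = 1 := by
  have hdet : (U : Matrix (Fin 2) (Fin 2) ℂ).det = 1 := (Matrix.mem_specialUnitaryGroup_iff.1 U.2).2
  rw [← quatMatrix_su2Quat, det_quatMatrix] at hdet
  exact_mod_cast hdet

/-- `‖su2Quat U‖ = 1`. [folklore] -/
theorem norm_su2Quat (U : SU2) : ‖su2Quat U‖ = 1 := by
  have h := normSq_su2Quat U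
  rw [Quaternion.normSq_eq_norm_mul_self] at h
  nlinarith [norm_nonneg (su2Quat U)]

/-- `su2Quat U ≠ 0`. [folklore] -/
theorem su2Quat_ne_zero (U : SU2) : su2Quat U ≠ 0 := by
  intro h
  have := norm_su2Quat U
  rw [h, norm_zero] at this
  exact zero_ne_one this

/-! ### The normalisation map `ℍ → SU(2)` -/

open scoped Classical in
/-- Radial projection of a non-zero quaternion to `SU(2)`: `x ↦ quatMatrix (x/‖x‖)` (junk value
`1` at `x = 0`). [folklore] -/
def quatToSU2 (x : ℍ) : SU2 :=
  if hx : x = 0 then 1 else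
    ⟨quatMatrix (‖x‖⁻¹ • x), quatMatrix_mem_specialUnitaryGroup (by
      rw [norm_smul, norm_inv, norm_norm, inv_mul_cancel₀ (norm_ne_zero_iff.2 hx)])⟩

/-- The matrix of `quatToSU2 x` for `x ≠ 0`. [folklore] -/
theorem coe_quatToSU2 {x : ℍ} (hx : x ≠ 0) :
    (quatToSU2 x : Matrix (Fin 2) (Fin 2) ℂ) = quatMatrix (‖x‖⁻¹ • x) := by
  rw [quatToSU2, dif_neg hx]

/-- On unit quaternions `quatToSU2` is `quatMatrix`. [folklore] -/
theorem coe_quatToSU2_of_norm_eq_one {x : ℍ} (hx : ‖x‖ = 1) :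
    (quatToSU2 x : Matrix (Fin 2) (Fin 2) ℂ) = quatMatrix x := by
  have hx0 : x ≠ 0 := by
    intro h; rw [h, norm_zero] at hx; exact zero_ne_one hx
  rw [coe_quatToSU2 hx0, hx, inv_one, one_smul]

/-- `quatToSU2` is onto: `quatToSU2 (su2Quat U) = U`. [folklore] -/
theorem quatToSU2_su2Quat (U : SU2) : quatToSU2 (su2Quat U) = U :=
  Subtype.ext (by rw [coe_quatToSU2_of_norm_eq_one (norm_su2Quat U), quatMatrix_su2Quat])

/-- **Equivariance**: left multiplication in `SU(2)` is left multiplication by the unit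
quaternion before projecting, `U · quatToSU2 x = quatToSU2 (su2Quat U · x)` (`x ≠ 0`).
[folklore] -/
theorem mul_quatToSU2 (U : SU2) {x : ℍ} (hx : x ≠ 0) :
    U * quatToSU2 x = quatToSU2 (su2Quat U * x) := by
  have hq := norm_su2Quat U
  have hqx : su2Quat U * x ≠ 0 := mul_ne_zero (su2Quat_ne_zero U) hx
  apply Subtype.ext
  rw [Submonoid.coe_mul, coe_quatToSU2 hx, coe_quatToSU2 hqx, ← quatMatrix_su2Quat U,
    ← quatMatrix_mul, mul_smul_comm, norm_mul, hq, one_mul]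

/-- `quatMatrix` is continuous. [folklore] -/
theorem continuous_quatMatrix : Continuous quatMatrix := by
  refine continuous_matrix fun i j => ?_
  have hmk : ∀ {a b : ℍ → ℝ}, Continuous a → Continuous b →
      Continuous fun q => (⟨a q, b q⟩ : ℂ) := fun ha hb =>
    (Complex.equivRealProdCLM.symm.continuous.comp (ha.prodMk hb)).congr fun q => rfl
  fin_cases i <;> fin_cases j
  · exact hmk Quaternion.continuous_re Quaternion.continuous_imI
  · exact hmk Quaternion.continuous_imJ Quaternion.continuous_imK
  · exact hmk Quaternion.continuous_imJ.neg Quaternion.continuous_imK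
  · exact hmk Quaternion.continuous_re Quaternion.continuous_imI.neg

/-- `quatToSU2` is continuous away from `0`. [folklore] -/
theorem continuousOn_quatToSU2 : ContinuousOn quatToSU2 {(0 : ℍ)}ᶜ := by
  rw [Topology.IsInducing.subtypeVal.continuousOn_iff]
  have h : ContinuousOn (fun x : ℍ => quatMatrix (‖x‖⁻¹ • x)) {(0 : ℍ)}ᶜ :=
    continuous_quatMatrix.comp_continuousOn
      ((continuousOn_id.norm.inv₀ fun x hx => norm_ne_zero_iff.2 hx).smul continuousOn_id)
  exact h.congr fun x hx => by
    simp only [Function.comp_apply]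
    exact coe_quatToSU2 hx

attribute [local instance] Literature.Analysis.FluidPDE.Tao2016.quatMeasurableSpace
  Literature.Analysis.FluidPDE.Tao2016.quatBorelSpace

/-- `quatToSU2` is (Borel) measurable. [folklore] -/
theorem measurable_quatToSU2 : Measurable quatToSU2 :=
  measurable_of_continuousOn_compl_singleton 0 continuousOn_quatToSU2

/-- `SU(2)` is second countable (a subspace of `ℂ^{2×2}`; recorded because instance search does
not unfold `Matrix`). [folklore] -/
theorem secondCountableTopology_su2 : SecondCountableTopology SU2 :=
  haveI : SecondCountableTopology (Matrix (Fin 2) (Fin 2) ℂ) :=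
    inferInstanceAs (SecondCountableTopology (Fin 2 → Fin 2 → ℂ))
  TopologicalSpace.Subtype.secondCountableTopology _

attribute [local instance] secondCountableTopology_su2

/-! ### The cone (radial projection) measure and its left invariance -/

/-- The law of `quatToSU2 x` for `x` uniform in the unit ball of `ℍ ≅ ℝ⁴` (equivalently, by
radial symmetry of the construction, of `x/‖x‖` for any rotation-invariant law: the normalised
surface measure of `S³` transported to `SU(2)`). [folklore] -/
def su2BallMeasure : Measure SU2 :=
  ((volume : Measure ℍ) (Metric.ball 0 1))⁻¹ •
    ((volume : Measure ℍ).restrict (Metric.ball 0 1)).map quatToSU2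

/-- The unit ball of `ℍ` has positive volume. [folklore] -/
theorem volume_ball_quat_ne_zero : (volume : Measure ℍ) (Metric.ball 0 1) ≠ 0 :=
  (Metric.measure_ball_pos volume (0 : ℍ) one_pos).ne'

/-- The unit ball of `ℍ` has finite volume. [folklore] -/
theorem volume_ball_quat_ne_top : (volume : Measure ℍ) (Metric.ball 0 1) ≠ ∞ :=
  measure_ball_lt_top.ne

/-- `su2BallMeasure` is a probability measure. [folklore] -/
theorem su2BallMeasure_univ : su2BallMeasure Set.univ = 1 := by
  rw [su2BallMeasure, Measure.smul_apply, Measure.map_apply measurable_quatToSU2 MeasurableSet.univ,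
    Set.preimage_univ, Measure.restrict_apply MeasurableSet.univ, Set.univ_inter, smul_eq_mul,
    ENNReal.inv_mul_cancel volume_ball_quat_ne_zero volume_ball_quat_ne_top]

/-- `su2BallMeasure` is a probability measure (instance). [folklore] -/
instance isProbabilityMeasure_su2BallMeasure : IsProbabilityMeasure su2BallMeasure :=
  ⟨su2BallMeasure_univ⟩

/-- Lebesgue measure restricted to the unit ball of `ℍ` is invariant under left multiplication
by a unit quaternion (a linear isometry preserving the ball). [folklore] -/
theorem map_mul_left_restrict_ball {q : ℍ} (hq : ‖q‖ = 1) :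
    ((volume : Measure ℍ).restrict (Metric.ball 0 1)).map (fun x => q * x) =
      (volume : Measure ℍ).restrict (Metric.ball 0 1) := by
  set e := (Literature.Analysis.FluidPDE.Tao2016.quatLmul q hq).toHomeomorph.toMeasurableEquiv
    with he
  have hcoe : (fun x : ℍ => q * x) = e := rfl
  have hpre : e ⁻¹' Metric.ball 0 1 = Metric.ball 0 1 := by
    ext x
    change q * x ∈ Metric.ball (0 : ℍ) 1 ↔ x ∈ Metric.ball (0 : ℍ) 1
    simp only [Metric.mem_ball, dist_zero_right, norm_mul, hq, one_mul]
  have hvol : (volume : Measure ℍ).map e = volume :=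
    (Literature.Analysis.FluidPDE.Tao2016.quatLmul q hq).measurePreserving.map_eq
  rw [hcoe]
  conv_rhs => rw [← hvol, e.measurableEmbedding.restrict_map, hpre]

/-- **Left invariance of the cone measure**: `su2BallMeasure` is invariant under left
translations of `SU(2)` — left multiplication by `U = quatMatrix q` is, before radial
projection, the linear isometry `x ↦ q x` of `ℍ`, which preserves Lebesgue measure and the unit
ball. (Chatterjee §3.2: "the pushforward of the normalized Haar measure under `τ` is the uniform
probability measure on `S³`, and conversely"; Bröcker–tom Dieck I §5 for invariant integration.)
[cite: Chatterjee2026YMHiggs, §3.2 (Haar on SU(2) and the uniform measure on S³)] -/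
theorem map_mul_left_su2BallMeasure (U : SU2) :
    su2BallMeasure.map (fun V => U * V) = su2BallMeasure := by
  have hmul : Measurable fun V : SU2 => U * V := (continuous_const_mul U).measurable
  rw [su2BallMeasure, Measure.map_smul, Measure.map_map hmul measurable_quatToSU2]
  congr 1
  have hae : (fun V : SU2 => U * V) ∘ quatToSU2 =ᵐ[(volume : Measure ℍ).restrict (Metric.ball 0 1)]
      quatToSU2 ∘ fun x => su2Quat U * x := by
    have h0 : ∀ᵐ x ∂(volume : Measure ℍ), x ≠ (0 : ℍ) := by
      rw [ae_iff]
      simp only [ne_eq, not_not, Set.setOf_eq_eq_singleton, measure_singleton]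
    filter_upwards [ae_restrict_of_ae h0] with x hx
    simp only [Function.comp_apply]
    exact mul_quatToSU2 U hx
  rw [Measure.map_congr hae, ← Measure.map_map measurable_quatToSU2
    ((continuous_const_mul (su2Quat U)).measurable), map_mul_left_restrict_ball (norm_su2Quat U)]

/-- `su2BallMeasure` is left invariant (instance form of `map_mul_left_su2BallMeasure`).
[folklore] -/
instance isMulLeftInvariant_su2BallMeasure : su2BallMeasure.IsMulLeftInvariant :=
  ⟨map_mul_left_su2BallMeasure⟩

/-! ### Identification with Haar measure and the integration formula -/

/-- **Haar measure on `SU(2)` is the cone measure of the unit quaternions**: the normalised Haar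
measure `haarProbability SU(2)` equals the law of `x/‖x‖` (as an `SU(2)` matrix) for `x` uniform
in the unit ball of `ℍ ≅ ℝ⁴`, i.e. the normalised `SO(4)`-invariant surface measure of `S³`
transported by the group isomorphism `S³ ≅ SU(2)`. Uniqueness of left-invariant probability
measures (Mathlib `haarMeasure_eq_iff`). (Chatterjee, arXiv:2401.10507, §3.2; Sepanski,
*Compact Lie Groups*, §1.1.4 (`SU(2) ≅ S³`).) [cite: Chatterjee2026YMHiggs, §3.2 (Haar on SU(2) and the uniform measure on S³)] -/
theorem haarProbability_su2_eq_su2BallMeasure :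
    QuantumFieldTheory.haarProbability SU2 = su2BallMeasure := by
  rw [QuantumFieldTheory.haarProbability]
  refine (Measure.haarMeasure_eq_iff ⊤ su2BallMeasure).2 ?_
  rw [TopologicalSpace.PositiveCompacts.coe_top]
  exact su2BallMeasure_univ

/-- **Integration over `SU(2)` as an average over the unit quaternion ball**: for measurable
`f ≥ 0`, `∫ f dHaar = vol(B⁴)⁻¹ ∫_{‖x‖ < 1} f(quatToSU2 x) dx`. [folklore] -/
theorem lintegral_haarProbability_su2 (f : SU2 → ℝ≥0∞) (hf : Measurable f) :
    ∫⁻ U, f U ∂(QuantumFieldTheory.haarProbability SU2) =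
      ((volume : Measure ℍ) (Metric.ball 0 1))⁻¹ *
        ∫⁻ x in Metric.ball (0 : ℍ) 1, f (quatToSU2 x) := by
  rw [haarProbability_su2_eq_su2BallMeasure, su2BallMeasure, lintegral_smul_measure,
    lintegral_map hf measurable_quatToSU2, smul_eq_mul]

/-- Bochner-integral form of `lintegral_haarProbability_su2`: for `f` a.e.-strongly measurable…
here for every `f` (the push-forward/average formula holds with junk values on both sides when
`f ∘ quatToSU2` is not integrable on the ball). [folklore] -/
theorem integral_haarProbability_su2 {F : Type*} [NormedAddCommGroup F] [NormedSpace ℝ F]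
    (f : SU2 → F) (hf : StronglyMeasurable f) :
    ∫ U, f U ∂(QuantumFieldTheory.haarProbability SU2) =
      (((volume : Measure ℍ) (Metric.ball 0 1))⁻¹).toReal •
        ∫ x in Metric.ball (0 : ℍ) 1, f (quatToSU2 x) := by
  rw [haarProbability_su2_eq_su2BallMeasure]
  unfold su2BallMeasure
  rw [integral_smul_measure, integral_map measurable_quatToSU2.aemeasurable hf.aestronglyMeasurable]

/-- The volume of the unit ball of `ℍ ≅ ℝ⁴` is `π²/2`. [folklore] -/
theorem volume_ball_quat : (volume : Measure ℍ) (Metric.ball 0 1) = ENNReal.ofReal (Real.pi ^ 2 / 2) := by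
  rw [InnerProductSpace.volume_ball (0 : ℍ) 1, Quaternion.finrank_eq_four]
  have hΓ : Real.Gamma (((4 : ℕ) : ℝ) / 2 + 1) = 2 := by
    rw [show ((4 : ℕ) : ℝ) / 2 + 1 = (2 : ℕ) + 1 by norm_num, Real.Gamma_nat_eq_factorial]
    norm_num
  rw [hΓ, ENNReal.ofReal_one, one_pow, one_mul]
  congr 1
  rw [show Real.sqrt Real.pi ^ 4 = (Real.sqrt Real.pi ^ 2) ^ 2 by ring,
    Real.sq_sqrt Real.pi_pos.le]

end Literature.MathematicalPhysics.QuantumLattice
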